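import Summits.ResolutionOfSingularities.ResolutionOfSingularities.Theorems.RadicialJungCleanModelsGiraudCoprincipalPart
import Mathlib.RingTheory.Ideal.KrullsHeightTheorem
import HarnessLib

/-!
# Route `RadicialJung`, crux `CleanModels` (stmt-15917): the principal hull `B(J)` is principal,
# and at a non-crossing point `B(J(X,f,E(f))) = (xᵃ)` (Giraud 1983, 2.1 and 2.5 "`B(J) = xᵃ𝒪_X`")

Support file (OURS) for PROGRAMME-clean-dim2 / T2 (`stub_step`, bricks B4/B5), line
`via-clean-models` of the crux `DescentPerfectToAll` (stmt-0549). Nothing here is a statement of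
Hironaka's manuscript.

Giraud (Bull. SMF 111 (1983)): 2.1 (1) "le bidual `B(I)` de `I` est un idéal inversible",
`D(I) = I·B(I)⁻¹`; 2.5 "Puisque `E(ω) = div(x)`, on a `B(J) = xᵃ𝒪_X`, avec `a ≥ 1`". With the
tree's Ω-free renderings (`principalHullIdeal`, `coprincipalPart`, `derivCriticalPrimes`,
`logDerivJacobianIdeal` of `Literature/AlgebraicGeometry/Resolution/GiraudLogJacobianIdeal.lean`)
and res-L1-s42-pv-2's `RadicialJungCleanModelsGiraudCoprincipalPart.lean`:

* `exists_principalHullIdeal_span_eq` — in a factorial domain the principal hull of a finitely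
  generated ideal is PRINCIPAL, generated by the gcd of the generators; hence
  `exists_principalHullIdeal_eq_span` for every ideal of a noetherian factorial domain, and
  `mem_coprincipalPart_iff_mul_mem`, `eq_span_singleton_mul_coprincipalPart`:
  `D(I) = (I : g)` and **`I = (g)·D(I)`** for `B(I) = (g)`;
* `exists_associated_pow_of_forall_prime_dvd` — an element all of whose prime factors are
  associated to the prime `x` is associated to a power of `x`;
* `associated_of_prime_of_logDerivJacobianIdeal_le_span` — **if the only critical prime of `f`
  is `(x)` (a non-crossing point of `E(f) = div(x)`), every prime element dividing the whole
  log-Jacobian ideal `J(O, f, E(f))` is associated to `x`** (`x·D` is logarithmic for every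
  derivation `D`, so such a prime `π ∤ x` would give a second critical prime `(π)`);
* `exists_principalHullIdeal_logDerivJacobianIdeal_eq_span_pow` — hence **`B(J) = (xᵃ)`,
  `D(J) = (J : xᵃ)`, `J = xᵃ·D(J)`**, and `J ⊆ xᵃ𝔪` when `c ≠ 0` — the hypothesis shape of
  `giraud_exactness` (`RadicialJungCleanModelsGiraudExactness.lean`) and of the chart bounds of
  `RadicialJungCleanModelsGiraudStepColength.lean`.

References: J. Giraud, Bull. SMF 111 (1983), 2.1, 2.5 [Giraud1983]. 
-/

noncomputable section

set_option linter.dupNamespace false -- mandated namespace of this single-conjunct summit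

open IsLocalRing Literature.AlgebraicGeometry.Resolution

namespace Summit.ResolutionOfSingularities.ResolutionOfSingularities.Theorems.RadicialJung.CleanModels

universe u

variable {O : Type u} [CommRing O]

/-! ## §1 The principal hull of a finitely generated ideal of a factorial domain is principal -/

section Hull

variable [IsDomain O] [UniqueFactorizationMonoid O]

omit [IsDomain O]

/-- **`B((s)) = (gcd s)`**: in a factorial domain the principal hull of the ideal generated by a
finite set `s` is generated by an element `g` dividing every member of `s` and divisible by every
common divisor of `s` (a gcd). [cite: Giraud1983, 2.1 (1)] -/
theorem exists_principalHullIdeal_span_eq (s : Finset O) :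
    ∃ g : O, (∀ a ∈ s, g ∣ a) ∧ (∀ h : O, (∀ a ∈ s, h ∣ a) → h ∣ g) ∧
      principalHullIdeal (Ideal.span (s : Set O)) = Ideal.span {g} := by
  classical
  letI : NormalizationMonoid O :=
    (UniqueFactorizationMonoid.strongNormalizationMonoid (α := O)).toNormalizationMonoid
  letI : NormalizedGCDMonoid O := UniqueFactorizationMonoid.toNormalizedGCDMonoid O
  refine ⟨s.gcd id, fun a ha => Finset.gcd_dvd ha, fun h hh => Finset.dvd_gcd hh, ?_⟩
  apply le_antisymm
  · refine principalHullIdeal_le_span_singleton ?_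
    rw [Ideal.span_le]
    intro a ha
    exact Ideal.mem_span_singleton.mpr (Finset.gcd_dvd (f := id) ha)
  · refine le_sInf ?_
    rintro P ⟨hP, hsP⟩
    rw [Ideal.span_singleton_le_iff_mem]
    obtain ⟨h, rfl⟩ := hP
    rw [Ideal.submodule_span_eq] at hsP ⊢
    refine Ideal.mem_span_singleton.mpr (Finset.dvd_gcd fun a ha => ?_)
    exact Ideal.mem_span_singleton.mp (hsP (Ideal.subset_span ha))

/-- Hence `B(I)` is principal for every finitely generated ideal `I` of a factorial domain (every
ideal of a noetherian one), with a generator `g` dividing all of `I` and divisible by every common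
divisor of `I`. [cite: Giraud1983, 2.1 (1)] -/
theorem exists_principalHullIdeal_eq_span {I : Ideal O} (hI : I.FG) :
    ∃ g : O, (∀ a ∈ I, g ∣ a) ∧ (∀ h : O, (∀ a ∈ I, h ∣ a) → h ∣ g) ∧
      principalHullIdeal I = Ideal.span {g} := by
  obtain ⟨s, rfl⟩ := hI
  obtain ⟨g, hgs, hhg, hB⟩ := exists_principalHullIdeal_span_eq s
  refine ⟨g, fun a ha => ?_, fun h hh => hhg h fun a ha => hh a (Ideal.subset_span ha), hB⟩
  have : Ideal.span (s : Set O) ≤ Ideal.span {g} :=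
    Ideal.span_le.mpr fun b hb => Ideal.mem_span_singleton.mpr (hgs b hb)
  exact Ideal.mem_span_singleton.mp (this ha)

end Hull

/-! ## §2 `D(I) = (I : g)` and `I = (g)·D(I)` when `B(I) = (g)` -/

/-- For `B(I) = (g)`: `a ∈ D(I) ↔ a g ∈ I`. [cite: Giraud1983, 2.1 (2)] -/
theorem mem_coprincipalPart_iff_mul_mem {I : Ideal O} {g : O}
    (hB : principalHullIdeal I = Ideal.span {g}) {a : O} : a ∈ coprincipalPart I ↔ a * g ∈ I := by
  rw [mem_coprincipalPart_iff, hB]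
  constructor
  · intro h; exact h g (Ideal.mem_span_singleton_self g)
  · intro h b hb
    obtain ⟨r, rfl⟩ := Ideal.mem_span_singleton'.mp hb
    have e : a * (r * g) = r * (a * g) := by ring
    rw [e]; exact I.mul_mem_left r h

/-- **`I = (g)·D(I)`** for `B(I) = (g)` (Giraud's `D(I) = I·B(I)⁻¹` read as an equality of ideals).
[cite: Giraud1983, 2.1 (2)] -/
theorem eq_span_singleton_mul_coprincipalPart {I : Ideal O} {g : O}
    (hB : principalHullIdeal I = Ideal.span {g}) : I = Ideal.span {g} * coprincipalPart I := by
  apply le_antisymm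
  · intro a ha
    have haB : a ∈ Ideal.span {g} := hB ▸ le_principalHullIdeal I ha
    obtain ⟨r, rfl⟩ := Ideal.mem_span_singleton'.mp haB
    rw [mul_comm r g]
    exact Ideal.mul_mem_mul (Ideal.mem_span_singleton_self g)
      ((mem_coprincipalPart_iff_mul_mem hB).mpr ha)
  · rw [Ideal.mul_le]
    intro b hb a ha
    obtain ⟨r, rfl⟩ := Ideal.mem_span_singleton'.mp hb
    have e : r * g * a = r * (a * g) := by ring
    rw [e]
    exact I.mul_mem_left r ((mem_coprincipalPart_iff_mul_mem hB).mp ha)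

/-- For `B(I) = (g)` and `D(I) ⊆ M`: `I ⊆ (g)·M` (e.g. `M = 𝔪` when `c ≠ 0`). [folklore] -/
theorem le_span_singleton_mul_of_coprincipalPart_le {I M : Ideal O} {g : O}
    (hB : principalHullIdeal I = Ideal.span {g}) (hM : coprincipalPart I ≤ M) :
    I ≤ Ideal.span {g} * M := by
  conv_lhs => rw [eq_span_singleton_mul_coprincipalPart hB]
  exact Ideal.mul_mono_right hM

/-! ## §3 Elements with all prime factors associated to `x` -/

section Factors

variable [IsDomain O] [UniqueFactorizationMonoid O]

omit [IsDomain O] in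

/-- In a factorial domain, a nonzero element all of whose prime factors are associated to the
prime `x` is associated to a power of `x`. [folklore] -/
theorem exists_associated_pow_of_forall_prime_dvd {x : O} (g : O) (hg0 : g ≠ 0)
    (h : ∀ π : O, Prime π → π ∣ g → Associated π x) : ∃ a : ℕ, Associated g (x ^ a) := by
  induction g using UniqueFactorizationMonoid.induction_on_prime with
  | h₁ => exact absurd rfl hg0
  | h₂ u hu => exact ⟨0, by rw [pow_zero]; exact associated_one_iff_isUnit.mpr hu⟩
  | h₃ a π ha0 hπ ih =>
    obtain ⟨k, hk⟩ := ih ha0 (fun ρ hρ hρa => h ρ hρ (dvd_mul_of_dvd_right hρa π))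
    have hπx : Associated π x := h π hπ (dvd_mul_right π a)
    exact ⟨k + 1, by rw [pow_succ']; exact hπx.mul_mul hk⟩

end Factors

/-! ## §4 At a non-crossing point: the common prime divisors of `J(O, f, E(f))` are `∼ x` -/

section Critical

variable [IsDomain O] [IsNoetherianRing O]

/-- A principal ideal generated by a prime element has height one. [folklore] -/
theorem height_span_singleton_eq_one_of_prime {π : O} (hπ : Prime π) :
    (Ideal.span {π}).height = 1 := by
  haveI : (Ideal.span {π}).IsPrime := (Ideal.span_singleton_prime hπ.ne_zero).mpr hπ
  apply le_antisymm
  · exact Ideal.height_le_one_of_isPrincipal_of_mem_minimalPrimes (Ideal.span {π}) _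
      (by rw [Ideal.minimalPrimes_eq_subsingleton_self]; exact Set.mem_singleton _)
  · exact Ideal.one_le_height_span_singleton_of_mem_nonZeroDivisors
      (mem_nonZeroDivisors_of_ne_zero hπ.ne_zero)

omit [IsDomain O] [IsNoetherianRing O] in
/-- `x · D f ∈ J(O, f, E(f))` for every derivation `D`, as soon as `x` lies in every critical prime
(`x·D` is then logarithmic along `E(f)`). [cite: Giraud1983, 1.1 (3)] -/
theorem mul_derivation_apply_mem_logDerivJacobianIdeal {x : O} (f : O)
    (hx : ∀ P ∈ derivCriticalPrimes O f, x ∈ P) (D : Derivation ℤ O O) :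
    x * D f ∈ logDerivJacobianIdeal O f := by
  refine Ideal.subset_span ⟨x • D, fun P hP a _ => ?_, by rw [Derivation.smul_apply, smul_eq_mul]⟩
  rw [Derivation.smul_apply, smul_eq_mul]
  exact P.mul_mem_right _ (hx P hP)

/-- **At a point where `(x)` is the ONLY critical prime, every prime element dividing all of
`J(O, f, E(f))` is associated to `x`.** If `π ∤ x`, then from `π ∣ x·Df` for all `D` we get
`J(O, f) ⊆ (π)`, so `(π)` (prime of height one) is a critical prime, i.e. `(π) = (x)`.
[cite: Giraud1983, 2.5] -/
theorem associated_of_prime_of_logDerivJacobianIdeal_le_span {x : O} (hx : Prime x) (f : O)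
    (hcrit : ∀ P : Ideal O, P ∈ derivCriticalPrimes O f ↔ P = Ideal.span {x})
    {π : O} (hπ : Prime π) (hle : logDerivJacobianIdeal O f ≤ Ideal.span {π}) :
    Associated π x := by
  by_cases hπx : π ∣ x
  · obtain ⟨w, hw⟩ := hπx
    rcases hx.irreducible.isUnit_or_isUnit hw with hu | hu
    · exact absurd hu hπ.not_unit
    · exact ⟨hu.unit, by rw [IsUnit.unit_spec, hw]⟩
  · -- `π ∣ D f` for every derivation
    have hxP : ∀ P ∈ derivCriticalPrimes O f, x ∈ P := fun P hP => by
      rw [(hcrit P).mp hP]; exact Ideal.mem_span_singleton_self x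
    have hdvd : ∀ D : Derivation ℤ O O, π ∣ D f := fun D =>
      (hπ.dvd_or_dvd (Ideal.mem_span_singleton.mp
        (hle (mul_derivation_apply_mem_logDerivJacobianIdeal f hxP D)))).resolve_left hπx
    have hJ : derivJacobianIdeal O f ≤ Ideal.span {π} := by
      unfold derivJacobianIdeal
      rw [Ideal.span_le]
      rintro _ ⟨D, rfl⟩
      exact Ideal.mem_span_singleton.mpr (hdvd D)
    have hP : Ideal.span {π} ∈ derivCriticalPrimes O f :=
      ⟨(Ideal.span_singleton_prime hπ.ne_zero).mpr hπ, height_span_singleton_eq_one_of_prime hπ, hJ⟩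
    exact (Ideal.span_singleton_eq_span_singleton.mp ((hcrit _).mp hP))

variable [UniqueFactorizationMonoid O]

/-- **`B(J(O, f, E(f))) = (xᵃ)` at a non-crossing point** (`J ≠ 0`): Giraud's "Puisque
`E(ω) = div(x)`, on a `B(J) = xᵃ𝒪_X`" — with `D(J) = (J : xᵃ)` and `J = xᵃ·D(J)`.
[cite: Giraud1983, 2.5] -/
theorem exists_principalHullIdeal_logDerivJacobianIdeal_eq_span_pow {x : O} (hx : Prime x) (f : O)
    (hcrit : ∀ P : Ideal O, P ∈ derivCriticalPrimes O f ↔ P = Ideal.span {x})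
    (hJ : logDerivJacobianIdeal O f ≠ ⊥) :
    ∃ a : ℕ, principalHullIdeal (logDerivJacobianIdeal O f) = Ideal.span {x ^ a} ∧
      (∀ r : O, r ∈ coprincipalPart (logDerivJacobianIdeal O f) ↔
        r * x ^ a ∈ logDerivJacobianIdeal O f) ∧
      logDerivJacobianIdeal O f = Ideal.span {x ^ a} * coprincipalPart (logDerivJacobianIdeal O f) := by
  set J := logDerivJacobianIdeal O f with hJdef
  obtain ⟨g, hgJ, hhg, hB⟩ := exists_principalHullIdeal_eq_span (I := J) (IsNoetherian.noetherian J)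
  have hg0 : g ≠ 0 := by
    intro h0
    apply hJ
    rw [← le_bot_iff]
    intro a ha
    have := hgJ a ha
    rw [h0, zero_dvd_iff] at this
    exact this
  obtain ⟨a, hga⟩ := exists_associated_pow_of_forall_prime_dvd g hg0 (fun π hπ hπg =>
    associated_of_prime_of_logDerivJacobianIdeal_le_span hx f hcrit hπ
      (fun b hb => Ideal.mem_span_singleton.mpr (hπg.trans (hgJ b hb))))
  have hB' : principalHullIdeal J = Ideal.span {x ^ a} := by
    rw [hB]; exact Ideal.span_singleton_eq_span_singleton.mpr hga
  exact ⟨a, hB', fun r => mem_coprincipalPart_iff_mul_mem hB',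
    eq_span_singleton_mul_coprincipalPart hB'⟩

end Critical

end Summit.ResolutionOfSingularities.ResolutionOfSingularities.Theorems.RadicialJung.CleanModels

end
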